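import Literature.AlgebraicGeometry.Frobenioids.Thm36SubIstrTypesQ
import Literature.AlgebraicGeometry.Frobenioids.ArchimedeanAmpleness
import Literature.AlgebraicGeometry.Frobenioids.FrobeniusTypePrime
import Literature.AlgebraicGeometry.Frobenioids.PerfectionOps
import HarnessLib

/-!
# Frobenioids II, Theorem 3.6 (i) for `C^ℚ := C^pf` — the typology clauses "`Aut`-ample, `Aut^sub`-ample,
# `End`-ample, metrically trivial, not group-like", PROVED over THE perfection (slot `Thm36Sub.ampleTypes_Q`)

Mochizuki, *The geometry of Frobenioids II: poly-Frobenioids*, Kyushu J. Math. **62** (2008) 401–460, §3,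
Theorem 3.6 (i), kurims text `paper:url-4322d76898e0` p. 36 l. −4 – −3: "the Frobenioid `C^Λ` is of
`Aut`-ample, `Aut^sub`-ample, `End`-ample, and metrically trivial type, but not of group-like type", here for
`Λ = ℚ`, i.e. `C^ℚ := C^pf` (Example 3.3 (ii) p. 28) [cite: MochizukiFrdII2008, Thm 3.6 (i) p.36].

PROOF-ONLY companion of the sub-DAG statements file `Thm36Sub.lean` (abc-iut cell, layer L1, row M13, slot
`Thm36Sub.ampleTypes_Q`; statements by abc-iut-w4-d074, proof by abc-iut-w5-d161), for THE perfection
`PreFrobenioid.Perfection hF` of the archimedean Frobenioid `C = C₀ ×_{D₀} D → F_Φ` of Example 3.3 over ANY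
base `π : D → D₀` (`hF` = print's "`C` is a Frobenioid", the input of the construction of `C^pf` — it also
carries "`D` is connected", [FrdI] Def. 1.3 standing hypothesis, used for the last clause):

* `Aut`-, `Aut^sub`-, `End`-AMPLE: an object `(A, n)` of `C^pf` has the same base object as `A`; an endomorphism or
  automorphism `g` of that base object, conjugated by the base-isomorphism `Base(A) ⥲ Base(A^{(1)})` of the
  chosen Frobenius arrow, lifts to `A^{(1)}` in `C` (Thm. 3.6 (i) for `C`: `isAutAmple_C`, `isAutSubAmple_C`,
  `isEndAmple_C`, seat abc-iut-L1-t6 lineage), and the class at the level `(1, 1)` of the lift is an endomorphism,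
  resp. automorphism, of `(A, n)` over `g` ([FrdI] Def. 3.1 (iii), Prop. 3.2 (i): `Base` of a class at level `(a, b)`
  is `Base(frob_A) ≫ Base(·) ≫ Base(frob_B)⁻¹`); for `Aut^sub` the witnessing square `β ≫ φ = φ ≫ α` of `C`
  (source `B`) is pushed to `C^pf` at the object `(B, n)` through the isomorphism `B ⥲ B^{(1)}` (a Frobenius-type
  arrow of degree `1` is an isomorphism, [FrdI] Prop. 1.10 (iv));
* METRICALLY TRIVIAL: a pre-step is a base-isomorphism, and base-isomorphic objects of `C^pf` are isomorphic
  (`Thm36Sub.nonempty_iso_of_baseIso`, the base-trivial clause proved in `Thm36SubIstrTypesQ.lean`);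
* NOT GROUP-LIKE: `D ≠ ∅` (from `hF`), and over any `B ∈ D` the divisor monoid of `C^pf` at `((tip-1 disc over
  B), 1)` is the perfection `(ℝ_{≥0})^pf`, in which `1^{1/1} ≠ 0` ([FrdI] §0: `a^{1/n} = 1` in `M^pf` iff some
  power of `a` is trivial).

Classical ([FrdII] §3 is a refereed preparatory paper); nothing here takes a side on [IUTchIII] Cor. 3.12.
-/

noncomputable section

namespace Literature.AlgebraicGeometry.Frobenioids

open CategoryTheory Opposite
open scoped NNReal

universe v u

namespace ArchFrd

namespace Thm36Sub

variable {D : Type u} [Category.{v} D] (π : D ⥤ D0)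

/-! ### Level-`(1,1)` classes of endomorphisms of `A^{(1)}` and their base maps -/

/-- `Base` of the class at level `(1, 1)` of an endomorphism `θ` of `A^{(1)}`:
`Base(frob_A) ≫ Base(θ) ≫ Base(frob_A)⁻¹` ([FrdI] Prop. 3.2 (i)). [cite: MochizukiFrdI2008, Prop. 3.2 (i) p.58] -/
theorem base_mk_one (hF : PreFrobenioid.IsFrobenioid (C.toElem π)) (X : PreFrobenioid.Perfection hF)
    (θ : PreFrobenioid.frobPow hF X.obj 1 ⟶ PreFrobenioid.frobPow hF X.obj 1) :
    PreFrobenioid.Base (pfStr π hF) (A := X) (B := X)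
        (PreFrobenioid.Perfection.Hom.mk (⟨⟨1, 1, rfl⟩, θ⟩ : PreFrobenioid.Perfection.Rep X X)) =
      PreFrobenioid.Base (C.toElem π) (PreFrobenioid.frob hF X.obj 1) ≫ PreFrobenioid.Base (C.toElem π) θ ≫
        PreFrobenioid.baseInvFrob hF X.obj 1 :=
  rfl

/-- Conjugating an arrow of `Base(A)` into `Base(A^{(1)})` and back. [cite: MochizukiFrdI2008, Prop. 3.2 (i) p.58] -/
theorem base_frob_conj (hF : PreFrobenioid.IsFrobenioid (C.toElem π)) (A : C π)
    (f : PreFrobenioid.baseObj (C.toElem π) A ⟶ PreFrobenioid.baseObj (C.toElem π) A) :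
    PreFrobenioid.Base (C.toElem π) (PreFrobenioid.frob hF A 1) ≫
        (PreFrobenioid.baseInvFrob hF A 1 ≫ f ≫ PreFrobenioid.Base (C.toElem π) (PreFrobenioid.frob hF A 1)) ≫
          PreFrobenioid.baseInvFrob hF A 1 = f := by
  simp only [Category.assoc, PreFrobenioid.base_frob_baseInvFrob, PreFrobenioid.base_frob_baseInvFrob_assoc,
    Category.comp_id]

/-! ### `End`-ample and `Aut`-ample -/

/-- **`C^pf` is of `End`-ample type**: `End((A, n)) → End_D(Base A)` is surjective (lift the conjugate of
`f` to `A^{(1)}` by `isEndAmple_C`, take its class at level `(1, 1)`). [cite: MochizukiFrdII2008, Thm 3.6 (i) p.36] -/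
theorem isEndAmple_pf (hF : PreFrobenioid.IsFrobenioid (C.toElem π)) (X : PreFrobenioid.Perfection hF) :
    PreFrobenioid.IsEndAmple (pfStr π hF) X := by
  intro f
  -- read `f` on `Base(A)` (the base object of `(A, n)` IS that of `A`)
  let f₀ : PreFrobenioid.baseObj (C.toElem π) X.obj ⟶ PreFrobenioid.baseObj (C.toElem π) X.obj := f
  obtain ⟨θ, hθ⟩ := isEndAmple_C π (PreFrobenioid.frobPow hF X.obj 1)
    (PreFrobenioid.baseInvFrob hF X.obj 1 ≫ f₀ ≫ PreFrobenioid.Base (C.toElem π) (PreFrobenioid.frob hF X.obj 1))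
  refine ⟨PreFrobenioid.Perfection.Hom.mk (⟨⟨1, 1, rfl⟩, θ⟩ : PreFrobenioid.Perfection.Rep X X), ?_⟩
  change PreFrobenioid.Base (C.toElem π) (PreFrobenioid.frob hF X.obj 1) ≫ PreFrobenioid.Base (C.toElem π) θ ≫
      PreFrobenioid.baseInvFrob hF X.obj 1 = f₀
  rw [hθ]
  exact base_frob_conj π hF X.obj f₀

/-- **`C^pf` is of `Aut`-ample type**: `Aut((A, n)) → Aut_D(Base A)` is surjective (lift the conjugate of
`g` to an automorphism of `A^{(1)}` by `isAutAmple_C`; its class at level `(1, 1)` is an automorphism of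
`(A, n)` by [FrdI] Prop. 3.2 (ii), `Perfection.isIso_mk_of_isIso`). [cite: MochizukiFrdII2008, Thm 3.6 (i) p.36] -/
theorem isAutAmple_pf (hF : PreFrobenioid.IsFrobenioid (C.toElem π)) (X : PreFrobenioid.Perfection hF) :
    PreFrobenioid.IsAutAmple (pfStr π hF) X := by
  intro g
  -- read `g` on `Base(A)` (the base object of `(A, n)` IS that of `A`)
  let g₀ : PreFrobenioid.baseObj (C.toElem π) X.obj ≅ PreFrobenioid.baseObj (C.toElem π) X.obj := g
  -- the conjugate automorphism of `Base(A^{(1)})`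
  let fr : PreFrobenioid.baseObj (C.toElem π) X.obj ⟶ PreFrobenioid.baseObj (C.toElem π) (PreFrobenioid.frobPow hF X.obj 1) :=
    PreFrobenioid.Base (C.toElem π) (PreFrobenioid.frob hF X.obj 1)
  let fri : PreFrobenioid.baseObj (C.toElem π) (PreFrobenioid.frobPow hF X.obj 1) ⟶ PreFrobenioid.baseObj (C.toElem π) X.obj :=
    PreFrobenioid.baseInvFrob hF X.obj 1
  have hfr : ∀ {Z : D} (h : PreFrobenioid.baseObj (C.toElem π) X.obj ⟶ Z), fr ≫ fri ≫ h = h := fun h =>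
    PreFrobenioid.base_frob_baseInvFrob_assoc hF X.obj 1 h
  have hfri : ∀ {Z : D} (h : PreFrobenioid.baseObj (C.toElem π) (PreFrobenioid.frobPow hF X.obj 1) ⟶ Z),
      fri ≫ fr ≫ h = h := fun h =>
    PreFrobenioid.baseInvFrob_base_frob_assoc hF X.obj 1 h
  let g' : PreFrobenioid.baseObj (C.toElem π) (PreFrobenioid.frobPow hF X.obj 1) ≅
      PreFrobenioid.baseObj (C.toElem π) (PreFrobenioid.frobPow hF X.obj 1) :=
    { hom := fri ≫ g₀.hom ≫ fr
      inv := fri ≫ g₀.inv ≫ fr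
      hom_inv_id := by
        simp only [Category.assoc]
        rw [hfr, Iso.hom_inv_id_assoc]
        exact PreFrobenioid.baseInvFrob_base_frob hF X.obj 1
      inv_hom_id := by
        simp only [Category.assoc]
        rw [hfr, Iso.inv_hom_id_assoc]
        exact PreFrobenioid.baseInvFrob_base_frob hF X.obj 1 }
  obtain ⟨α₁, hα₁⟩ := isAutAmple_C π (PreFrobenioid.frobPow hF X.obj 1) g'
  let r : PreFrobenioid.Perfection.Rep X X := ⟨⟨1, 1, rfl⟩, α₁.hom⟩
  haveI : IsIso (X := X) (Y := X) (PreFrobenioid.Perfection.Hom.mk r) :=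
    PreFrobenioid.Perfection.isIso_mk_of_isIso r (inferInstance : IsIso α₁.hom)
  refine ⟨asIso (PreFrobenioid.Perfection.Hom.mk r), Iso.ext ?_⟩
  have h1 : PreFrobenioid.Base (C.toElem π) α₁.hom = fri ≫ g₀.hom ≫ fr := congrArg Iso.hom hα₁
  change PreFrobenioid.Base (C.toElem π) (PreFrobenioid.frob hF X.obj 1) ≫ PreFrobenioid.Base (C.toElem π) α₁.hom ≫
      PreFrobenioid.baseInvFrob hF X.obj 1 = g₀.hom
  rw [h1]
  exact base_frob_conj π hF X.obj g₀.hom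

/-! ### `Aut^sub`-ample -/

/-- The class at level `(1, 1)` of a composite of endomorphisms of `A^{(1)}`-type representatives is the
composite of the classes (composition in `C^pf` at the triple level `(1, 1, 1)`).
[cite: MochizukiFrdI2008, Def. 3.1 (iii) p.57] -/
theorem mk_one_comp (hF : PreFrobenioid.IsFrobenioid (C.toElem π)) {X Y Z : PreFrobenioid.Perfection hF}
    (hXY : X.idx * 1 = Y.idx * 1) (hYZ : Y.idx * 1 = Z.idx * 1)
    (φ : PreFrobenioid.frobPow hF X.obj 1 ⟶ PreFrobenioid.frobPow hF Y.obj 1)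
    (ψ : PreFrobenioid.frobPow hF Y.obj 1 ⟶ PreFrobenioid.frobPow hF Z.obj 1) :
    PreFrobenioid.Perfection.Hom.comp
        (PreFrobenioid.Perfection.Hom.mk (⟨⟨1, 1, hXY⟩, φ⟩ : PreFrobenioid.Perfection.Rep X Y))
        (PreFrobenioid.Perfection.Hom.mk (⟨⟨1, 1, hYZ⟩, ψ⟩ : PreFrobenioid.Perfection.Rep Y Z)) =
      PreFrobenioid.Perfection.Hom.mk (⟨⟨1, 1, hXY.trans hYZ⟩, φ ≫ ψ⟩ : PreFrobenioid.Perfection.Rep X Z) := by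
  let T : PreFrobenioid.Perfection.Level₃ X Y Z := ⟨1, 1, 1, hXY, hYZ⟩
  rw [PreFrobenioid.Perfection.Hom.mk_comp_mk,
    ← PreFrobenioid.Perfection.mk_compAt T (⟨⟨1, 1, hXY⟩, φ⟩ : PreFrobenioid.Perfection.Rep X Y)
      (⟨⟨1, 1, hYZ⟩, ψ⟩ : PreFrobenioid.Perfection.Rep Y Z)
      (PreFrobenioid.Perfection.Level.le_rfl _) (PreFrobenioid.Perfection.Level.le_rfl _)]
  unfold PreFrobenioid.Perfection.compAt
  rw [PreFrobenioid.Perfection.Level.lift_rfl, PreFrobenioid.Perfection.Level.lift_rfl]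

/-- **`C^pf` is of `Aut^sub`-ample type**: a sub-automorphism `f` of `Base A` (`β' ≫ φ' = φ' ≫ f` in `D`)
lifts, after conjugation into `Base(A^{(1)})`, to a sub-automorphism `α₁` of `A^{(1)}` in `C` (`isAutSubAmple_C`,
witnessed by `β₁ ≫ φ₁ = φ₁ ≫ α₁` with source `B₁`); the classes at level `(1, 1)` of `α₁`, of
`frob_{B₁}⁻¹ ≫ φ₁` and of `frob_{B₁}⁻¹ ≫ β₁ ≫ frob_{B₁}` (the degree-one Frobenius arrow `B₁ → B₁^{(1)}` being
an isomorphism) witness that the class of `α₁` is a sub-automorphism of `(A, n)` with source `(B₁, n)`.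
[cite: MochizukiFrdII2008, Thm 3.6 (i) p.36] -/
theorem isAutSubAmple_pf (hF : PreFrobenioid.IsFrobenioid (C.toElem π)) (X : PreFrobenioid.Perfection hF) :
    PreFrobenioid.IsAutSubAmple (pfStr π hF) X := by
  rintro f ⟨B', φ', β', hβ⟩
  -- read `f`, `φ'` on `Base(A)` (the base object of `(A, n)` IS that of `A`)
  let f₀ : PreFrobenioid.baseObj (C.toElem π) X.obj ⟶ PreFrobenioid.baseObj (C.toElem π) X.obj := f
  let φ₀ : B' ⟶ PreFrobenioid.baseObj (C.toElem π) X.obj := φ'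
  have hβ₀ : β'.hom ≫ φ₀ = φ₀ ≫ f₀ := hβ
  -- the conjugated sub-automorphism of `Base(A^{(1)})`
  let fr : PreFrobenioid.baseObj (C.toElem π) X.obj ⟶ PreFrobenioid.baseObj (C.toElem π) (PreFrobenioid.frobPow hF X.obj 1) :=
    PreFrobenioid.Base (C.toElem π) (PreFrobenioid.frob hF X.obj 1)
  let fri : PreFrobenioid.baseObj (C.toElem π) (PreFrobenioid.frobPow hF X.obj 1) ⟶ PreFrobenioid.baseObj (C.toElem π) X.obj :=
    PreFrobenioid.baseInvFrob hF X.obj 1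
  have hfr : ∀ {Z : D} (h : PreFrobenioid.baseObj (C.toElem π) X.obj ⟶ Z), fr ≫ fri ≫ h = h := fun h =>
    PreFrobenioid.base_frob_baseInvFrob_assoc hF X.obj 1 h
  let f' : PreFrobenioid.baseObj (C.toElem π) (PreFrobenioid.frobPow hF X.obj 1) ⟶
      PreFrobenioid.baseObj (C.toElem π) (PreFrobenioid.frobPow hF X.obj 1) := fri ≫ f₀ ≫ fr
  have hf' : f' ∈ autSub (PreFrobenioid.baseObj (C.toElem π) (PreFrobenioid.frobPow hF X.obj 1)) := by
    refine ⟨B', φ₀ ≫ fr, β', ?_⟩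
    change β'.hom ≫ φ₀ ≫ fr = (φ₀ ≫ fr) ≫ fri ≫ f₀ ≫ fr
    rw [← Category.assoc, hβ₀, Category.assoc, Category.assoc, hfr]
  obtain ⟨α₁, ⟨B₁, φ₁, β₁, hsq⟩, hα₁⟩ := isAutSubAmple_C π (PreFrobenioid.frobPow hF X.obj 1) f' hf'
  -- the source object `(B₁, n)` and the degree-one Frobenius ISOMORPHISM `B₁ ⥲ B₁^{(1)}`
  let W : PreFrobenioid.Perfection hF := ⟨B₁, X.idx⟩
  haveI : IsIso (PreFrobenioid.frob hF B₁ 1) :=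
    PreFrobenioid.isIso_of_isFrobeniusType_of_degFr_eq_one hF (PreFrobenioid.isFrobeniusType_frob hF B₁ 1)
      (PreFrobenioid.degFr_frob hF B₁ 1)
  let ι := PreFrobenioid.frob hF B₁ 1
  -- the three classes at level `(1, 1)`
  let rα : PreFrobenioid.Perfection.Rep X X := ⟨⟨1, 1, rfl⟩, α₁⟩
  let rφ : PreFrobenioid.Perfection.Rep W X := ⟨⟨1, 1, rfl⟩, inv ι ≫ φ₁⟩
  let rβ : PreFrobenioid.Perfection.Rep W W := ⟨⟨1, 1, rfl⟩, inv ι ≫ β₁.hom ≫ ι⟩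
  haveI : IsIso (X := W) (Y := W) (PreFrobenioid.Perfection.Hom.mk rβ) :=
    PreFrobenioid.Perfection.isIso_mk_of_isIso rβ (by change IsIso (inv ι ≫ β₁.hom ≫ ι); infer_instance)
  refine ⟨PreFrobenioid.Perfection.Hom.mk rα,
    ⟨W, PreFrobenioid.Perfection.Hom.mk rφ, asIso (PreFrobenioid.Perfection.Hom.mk rβ), ?_⟩, ?_⟩
  · -- the square `β ≫ φ = φ ≫ α` in `C^pf`, computed at the triple level `(1, 1, 1)`
    change PreFrobenioid.Perfection.Hom.comp (PreFrobenioid.Perfection.Hom.mk rβ)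
        (PreFrobenioid.Perfection.Hom.mk rφ) =
      PreFrobenioid.Perfection.Hom.comp (PreFrobenioid.Perfection.Hom.mk rφ) (PreFrobenioid.Perfection.Hom.mk rα)
    rw [mk_one_comp, mk_one_comp]
    congr 2
    simp only [Category.assoc, IsIso.hom_inv_id_assoc, hsq]
  · -- its base map is `f`
    change PreFrobenioid.Base (C.toElem π) (PreFrobenioid.frob hF X.obj 1) ≫ PreFrobenioid.Base (C.toElem π) α₁ ≫
        PreFrobenioid.baseInvFrob hF X.obj 1 = f₀
    rw [hα₁]
    exact base_frob_conj π hF X.obj f₀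

/-! ### Metrically trivial -/

/-- **`C^pf` is of metrically trivial type**: the codomain of a (co-angular) pre-step `(A, n) → (B, m)` is
isomorphic to `(A, n)` — a pre-step is a base-isomorphism, and base-isomorphic objects of `C^pf` are isomorphic
(`Thm36Sub.nonempty_iso_of_baseIso`). [cite: MochizukiFrdII2008, Thm 3.6 (i) p.36] -/
theorem isMetricallyTrivial_pf (hF : PreFrobenioid.IsFrobenioid (C.toElem π)) (X : PreFrobenioid.Perfection hF) :
    PreFrobenioid.IsMetricallyTrivial (pfStr π hF) X := by
  intro Y ψ _ hpre
  haveI : IsIso (PreFrobenioid.Base (pfStr π hF) ψ) := hpre.2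
  exact nonempty_iso_of_baseIso π hF X Y (asIso (PreFrobenioid.Base (pfStr π hF) ψ)).symm

/-! ### Not group-like -/

/-- **`C^pf` is not of group-like type**: over any `B ∈ D` (`D ≠ ∅`, a standing hypothesis carried by `hF`)
the divisor monoid `Φ^pf = (ℝ_{≥0})^pf` at the object `((tip-1 disc over B), 1)` has the nontrivial element
`1^{1/1}`. [cite: MochizukiFrdII2008, Thm 3.6 (i) p.36] -/
theorem not_isOfType_isGroupLikeObj_pf (hF : PreFrobenioid.IsFrobenioid (C.toElem π)) :
    ¬ PreFrobenioid.IsOfType (PreFrobenioid.IsGroupLikeObj (pfStr π hF)) := by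
  obtain ⟨⟨B⟩, -⟩ := hF.isPreFrobenioid.isGraphConnected_base
  intro h
  have h1 : (Frobenioids.Perfection.mk (Multiplicative.ofAdd (1 : ℝ≥0)) 1 :
      Frobenioids.Perfection (Multiplicative ℝ≥0)) = 1 :=
    h (PreFrobenioid.Perfection.root hF (unitObjOver π B) 1)
      (Frobenioids.Perfection.mk (Multiplicative.ofAdd (1 : ℝ≥0)) 1)
  rw [Frobenioids.Perfection.mk_eq_one_iff] at h1
  obtain ⟨N, hN⟩ := h1
  have h2 := congrArg Multiplicative.toAdd hN
  rw [toAdd_pow, toAdd_ofAdd, toAdd_one, nsmul_eq_mul, mul_one] at h2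
  exact N.ne_zero (by exact_mod_cast h2)

/-! ### Theorem 3.6 (i), typology clauses, for `C^ℚ = C^pf` -/

/-- **Thm. 3.6 (i) for `C^ℚ = C^pf`** (p. 36 l. −4 – −3): "the Frobenioid `C^Λ` is of `Aut`-ample,
`Aut^sub`-ample, `End`-ample, and metrically trivial type, but not of group-like type", `Λ = ℚ`, PROVED over
THE perfection — closes the slot `Thm36Sub.ampleTypes_Q` for every value of its parameter `hF` (the input of
d9's construction of `C^pf`, print's "`C` is a Frobenioid", which also supplies "`D` connected ≠ ∅" for the
last clause). [cite: MochizukiFrdII2008, Thm 3.6 (i) p.36] -/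
theorem ampleTypes_Q_holds (hF : PreFrobenioid.IsFrobenioid (C.toElem π)) :
    Literature.AlgebraicGeometry.Frobenioids.ArchFrd.Thm36Sub.ampleTypes_Q π hF :=
  ⟨isAutAmple_pf π hF, isAutSubAmple_pf π hF, isEndAmple_pf π hF, isMetricallyTrivial_pf π hF,
    not_isOfType_isGroupLikeObj_pf π hF⟩

/-- The `Λ = ℚ` conjunct of t9's instance `Thm36i_ampleTypes_C π (pfCompletion hF) rlf`-family statement holds
(definitional bridge `archFrobenioid_pfCompletion_Q_str`). [cite: MochizukiFrdII2008, Thm 3.6 (i) p.36] -/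
theorem thm36i_ampleTypes_instance_Q (hF : PreFrobenioid.IsFrobenioid (C.toElem π)) (rlf : LambdaCompletion π) :
    Thm36i_ampleTypes (archFrobenioid π (pfCompletion π hF) rlf .Q).str :=
  ampleTypes_Q_holds π hF

end Thm36Sub

end ArchFrd

end Literature.AlgebraicGeometry.Frobenioids

end
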